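import Summits.CriticalPhenomena.PercolationContinuityZ3.Theorems.Transplant.PlanarSkeletonFrmScaledRayHolds
import Summits.CriticalPhenomena.PercolationContinuityZ3.Theorems.Transplant.PlanarSkeletonConcBoxProd
import HarnessLib

/-!
# Products `X □ G` for the scaled one-type node: `X` vertex-transitive, `G` carrying a one-type `PlanarSkeletonFrmScaled` — in particular
# `X □ Cay(Γ; S)` for EVERY finite generating `S` of every `CayleyScaled` group, modulo the node ALONE

builds on p205010 (kernel theorem, internal audit signed; external expert review pending) — nothing in this file uses p205010.  Every theorem below
is CONDITIONAL on the OPEN node `SamePDropOfSkeletonFrmScaled₁` (hypothesis `hN` / `hD`; nothing is claimed about it) and on NOTHING ELSE.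
Lane `prim-bschramm`, seat `prim-bschramm-p4` gen 16 (PART C3 of `P4-GENERAL.md` §38.9, gen-17 menu item (c) done early).  Helper file
(`--supports stmt-CriticalPhenomena-4575 --as helper`).

* `PlanarSkeletonFrmScaled.boxProdLeft X x₀ htr hc Ψ : PlanarSkeletonFrmScaled (X □ G)` — chart `Ψ.φ ∘ Prod.snd`, same `L`, `N`, `ℓ₀`, base vertices
  `{x₀} × Ψ.types` (so ONE type stays ONE type: `X` is vertex-TRANSITIVE, `htr : ∀ x, ∃ γ : X ≃g X, γ x₀ = x`), frames `boxProdIso γ α`, degree bound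
  `deg_X(x₀) + Δ`, steps in the `G`-slices, cylinders `X × cyl` connected (`induce_univ_prod_connected`);
* `boxProd_continuity_of_frmScaledNode₁` — `θ_v(p_c(X □ G)) = 0` at every vertex for every connected locally finite vertex-transitive `X` and every
  connected `G` with a one-type scaled skeleton, modulo the node alone (Φ2 by `cylSubcritical_criticalProb`);
* **`CayleyScaled.boxProd_criticalContinuity`** — `X □ Cay(Γ; S)`, `S` ANY finite generating set of a group with a rank-2 homomorphism to `ℤ²` with
  finitely generated kernel (e.g. `X □ Cay(ℤ^d; S)`, `X □ Cay(H₃(ℤ); S)`, `X □ Cay(N_{m,c}; S)`).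
[cite: BenjaminiSchramm1996, Conj. 4; §2 (almost transitive graphs, products)] [cite: KozmaNitzan2024, §4 p. 15 (boxes)]
-/

noncomputable section

namespace Summit.CriticalPhenomena.PercolationContinuityZ3.Theorems.Transplant

open SimpleGraph Literature.Probability.LatticeModels Literature.Probability.Percolation
open scoped Classical

variable {W V : Type}

namespace PlanarSkeletonFrmScaled

/-- **The product skeleton `X □ G`** of a vertex-transitive connected locally finite `X` (base point `x₀`) and a `PlanarSkeletonFrmScaled` of `G`:
chart `Ψ.φ ∘ Prod.snd`, base vertices `{x₀} × Ψ.types`, frames `boxProdIso γ α`. [cite: BenjaminiSchramm1996, §2 (almost transitive graphs)] -/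
def boxProdLeft (X : SimpleGraph W) [X.LocallyFinite] (x₀ : W) (htr : ∀ x : W, ∃ γ : X ≃g X, γ x₀ = x) (hc : X.Connected)
    {G : SimpleGraph V} [G.LocallyFinite] (Ψ : PlanarSkeletonFrmScaled G) : PlanarSkeletonFrmScaled (X □ G) where
  φ := fun v => Ψ.φ v.2
  L := Ψ.L
  lip := fun u v h i => by
    rcases boxProd_adj.1 h with ⟨_, h2⟩ | ⟨h2, _⟩
    · rw [h2, sub_self, abs_zero]; positivity
    · exact Ψ.lip h2 i
  types := ({x₀} : Finset W) ×ˢ Ψ.types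
  frame := fun v => by
    obtain ⟨t, ht, α, hαt, hα⟩ := Ψ.frame v.2
    obtain ⟨γ, hγ⟩ := htr v.1
    refine ⟨(x₀, t), Finset.mem_product.2 ⟨Finset.mem_singleton_self _, ht⟩, boxProdIso γ α, ?_, fun w => ?_⟩
    · rw [boxProdIso_apply, hγ, hαt]
    · rw [boxProdIso_apply]
      exact hα w.2
  Δ := X.degree x₀ + Ψ.Δ
  degree_le := fun v => by
    obtain ⟨γ, hγ⟩ := htr v.1
    have hdeg : X.degree v.1 = X.degree x₀ := by rw [← hγ, Iso.degree_eq]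
    rw [degree_boxProd, hdeg]
    exact add_le_add le_rfl (Ψ.degree_le v.2)
  N := Ψ.N
  one_le_N := Ψ.one_le_N
  step := fun v i σ => by
    obtain ⟨u', hadj, hu'⟩ := Ψ.step v.2 i σ
    exact ⟨(v.1, u'), (boxProd_adj (x := v) (y := (v.1, u'))).2 (Or.inr ⟨hadj, rfl⟩), hu'⟩
  ℓ₀ := Ψ.ℓ₀
  cyl_connected := fun t ht ℓ hℓ => by
    have ht2 : t.2 ∈ Ψ.types := (Finset.mem_product.1 ht).2
    have e : {w : W × V | Ψ.φ w.2 - Ψ.φ t.2 ∈ box 2 ℓ} = (Set.univ : Set W) ×ˢ {u : V | Ψ.φ u - Ψ.φ t.2 ∈ box 2 ℓ} := by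
      ext w; simp
    change ((X □ G).induce {w : W × V | Ψ.φ w.2 - Ψ.φ t.2 ∈ box 2 ℓ}).Connected
    rw [e]
    exact induce_univ_prod_connected X G hc (Ψ.cyl_connected t.2 ht2 ℓ hℓ)

/-- The base vertices of the product skeleton. [folklore] -/
theorem boxProdLeft_types (X : SimpleGraph W) [X.LocallyFinite] (x₀ : W) (htr : ∀ x : W, ∃ γ : X ≃g X, γ x₀ = x) (hc : X.Connected)
    {G : SimpleGraph V} [G.LocallyFinite] (Ψ : PlanarSkeletonFrmScaled G) : (Ψ.boxProdLeft X x₀ htr hc).types = ({x₀} : Finset W) ×ˢ Ψ.types := rfl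

/-- **`θ_v(p_c(X □ G)) = 0` at every vertex, modulo the scaled node ALONE**, for every connected locally finite vertex-transitive `X` and every connected
locally finite `G` with a one-type `PlanarSkeletonFrmScaled`. [cite: BenjaminiSchramm1996, Conj. 4; §2] -/
theorem boxProd_continuity_of_frmScaledNode₁ (hD : SamePDropOfSkeletonFrmScaled₁) (X : SimpleGraph W) [X.LocallyFinite] (x₀ : W)
    (htr : ∀ x : W, ∃ γ : X ≃g X, γ x₀ = x) (hc : X.Connected) {G : SimpleGraph V} [G.LocallyFinite] (Ψ : PlanarSkeletonFrmScaled G) (t : V)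
    (ht : t ∈ Ψ.types) (h1 : Ψ.types = {t}) (v : W × V) : theta (X □ G) v (criticalProbIOf (X □ G) v) = 0 := by
  have h1' : (Ψ.boxProdLeft X x₀ htr hc).types = {(x₀, t)} := by
    rw [boxProdLeft_types, h1, Finset.singleton_product_singleton]
  exact continuity_of_frmScaledNode₁_ray hD (X □ G) (Ψ.boxProdLeft X x₀ htr hc) (x₀, t)
    (by rw [boxProdLeft_types]; exact Finset.mem_product.2 ⟨Finset.mem_singleton_self _, ht⟩) h1' v

end PlanarSkeletonFrmScaled

/-! ## Products with Cayley graphs, every generating set -/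

namespace CayleyScaled

variable {Γ : Type} [Group Γ] {S : Finset Γ}

/-- **THEOREM (modulo the scaled node ALONE): `θ_v(p_c) = 0` on `X □ Cay(Γ; S)` at every vertex** — `X` ANY connected locally finite vertex-transitive
graph, `S` ANY finite generating set of a group with a rank-2 homomorphism to `ℤ²` with finitely generated kernel. [cite: BenjaminiSchramm1996, Conj. 4; §2] -/
theorem boxProd_criticalContinuity (C : CayleyScaled Γ S) (hN : SamePDropOfSkeletonFrmScaled₁) (X : SimpleGraph W) [X.LocallyFinite] (x₀ : W)
    (htr : ∀ x : W, ∃ γ : X ≃g X, γ x₀ = x) (hc : X.Connected) (v : W × Γ) :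
    theta (X □ mulCayley (↑S : Set Γ)) v (criticalProbIOf (X □ mulCayley (↑S : Set Γ)) v) = 0 :=
  PlanarSkeletonFrmScaled.boxProd_continuity_of_frmScaledNode₁ hN X x₀ htr hc C.skeletonFrmScaled 1
    (by rw [C.skeletonFrmScaled_types]; exact Finset.mem_singleton_self _) C.skeletonFrmScaled_types v

end CayleyScaled

/-- **`X □ Cay(ℤ^d; S)`**, every `d ≥ 2`, EVERY finite generating `S`, every connected locally finite vertex-transitive `X` — modulo the scaled node
ALONE. [cite: BenjaminiSchramm1996, Conj. 4; §2] -/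
theorem ZdGens.boxProd_criticalContinuity {d : ℕ} (hd : 2 ≤ d) (hN : SamePDropOfSkeletonFrmScaled₁) (S : Finset (Site d))
    (hS : AddSubgroup.closure (S : Set (Site d)) = ⊤) (X : SimpleGraph W) [X.LocallyFinite] (x₀ : W)
    (htr : ∀ x : W, ∃ γ : X ≃g X, γ x₀ = x) (hc : X.Connected) (v : W × Multiplicative (Site d)) :
    theta (X □ mulCayley (mulGens S : Set (Multiplicative (Site d)))) v
      (criticalProbIOf (X □ mulCayley (mulGens S : Set (Multiplicative (Site d)))) v) = 0 :=
  (ZdGens.scaled hd S hS).boxProd_criticalContinuity hN X x₀ htr hc v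

/-- **`X □ Cay(N_{m+2,c+1}; S')`**, the free nilpotent group of every rank and class, EVERY finite generating `S'` — modulo the scaled node ALONE.
builds on p205010 (kernel theorem, internal audit signed; external expert review pending). [cite: BenjaminiSchramm1996, Conj. 4; §2] -/
theorem FreeNilClass.boxProd_anyGens_criticalContinuity (m c : ℕ) (hN : SamePDropOfSkeletonFrmScaled₁) (S' : Finset (FreeNilClass.N m c))
    (hS' : Subgroup.closure (S' : Set (FreeNilClass.N m c)) = ⊤) (X : SimpleGraph W) [X.LocallyFinite] (x₀ : W)
    (htr : ∀ x : W, ∃ γ : X ≃g X, γ x₀ = x) (hc : X.Connected) (v : W × FreeNilClass.N m c) :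
    theta (X □ mulCayley (↑S' : Set (FreeNilClass.N m c))) v (criticalProbIOf (X □ mulCayley (↑S' : Set (FreeNilClass.N m c))) v) = 0 :=
  ((FreeNilClass.cayleyFrm₃ m c).scaledOf S' hS').boxProd_criticalContinuity hN X x₀ htr hc v

end Summit.CriticalPhenomena.PercolationContinuityZ3.Theorems.Transplant

end
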